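import Summits.CriticalPhenomena.PercolationContinuityZ3.Theorems.PercNearOneGluingNoHeavyLowerTailCSHUnfoldDecoy
import Summits.CriticalPhenomena.PercolationContinuityZ3.Theorems.PercNearOneGluingNoHeavyLowerTailCSHUnfold
import HarnessLib

/-!
# Conjecture G / SET-W via a SET observer, V: the DEFECT LEMMA of the set-observer unfolding
# (Markov at the clusters of the observer set + monotonicity of the unfolded functional Φ)

Support file (`--supports stmt-CriticalPhenomena-4576`); no definitions, no named facts, no sorries.  Seat (b) V⁺-form `png-dp-vplus`, gen 12
(memo MEMO-gen12.md §4(c) of run/shared/lean/prim/prim-png-dp-vplus/).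

In the world-wise unfolding of the SET-observer conditioned slack hierarchy (memo §4(b)), the moment of the telescoping residual
`Θ = 1{x↮Y}(g(C_x) − ḡ(C_Y))` (`CSH.resid`) against the observer indicator of a decoy `d` with avoided set `A ⊇ {x} ∪ Y`,
`g_O = 1{O ~ d}·1{O ≁ A}`, is NOT a moment against a function of `C_d` (as it is for a point observer, `CSH.sum_resid_mul_clusterFn`);
instead one has the inequality (the "defect lemma")
* `sum_resid_obs_le`:  `Σ_ζ w(ζ)·Θ(ζ)·g_O(ζ) ≤ −Σ_ζ w(ζ)·g_O(ζ)·Φ(C_d(ζ))`  (`Φ` = prim-hp-8's unfolded functional, `CSH.phiS`),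
which is what makes the sub-instance of the induction a set-CSH instance of lower level.  Proof (memo §4(c)): Markov at `C_d`
(`HullPort.set_sum_cond_sdiff`), then, in the world off `C_d`, Markov at the clusters of the observers outside `C_d`
(`CSH.set_sum_cond_sdiff_off`): on `{O' ≁ A}` the residual does not see those clusters, its fresh mean off `V(C_d) ∪ V(C_{O'})` is
`−Φ(V(C_d) ∪ V(C_{O'})) ≤ −Φ(V(C_d))` by Lemma Φ(a) (`CSH.sum_phiIntegrand_eq`) and the monotonicity of `Φ` (`CSH.phiIntegrand_mono`).
Tools: `edgesOf_union`, `barOf_eq_edgesOf`, `cut_sdiff_cut_of_avoid`, `resid_sdiff_cut_of_avoid` (deleting the cut set of a vertex set not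
joined to `x` nor to `Y` does not change the residual).
[cite: VandenbergHaggstromKahn2005, §2.1 Lemma 2.4 (p. 10); §1 display (10) (pp. 7–8)] [cite: KozmaNitzan2024, Conj. 4 (p. 32)]
-/

noncomputable section

namespace Summit.CriticalPhenomena.PercolationContinuityZ3.Theorems

open MeasureTheory Set Literature.Probability.LatticeModels Literature.Probability.Percolation
open scoped Classical
open BHK2006 DecisionTree HullPort

namespace CSH

variable {V : Type*}

/-- `edgesOf` of a union. [folklore] -/
theorem edgesOf_union (K K' : Set V) : edgesOf (K ∪ K') = edgesOf K ∪ edgesOf K' := by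
  ext e
  simp only [edgesOf, mem_setOf_eq, mem_union]
  constructor
  · rintro ⟨u, hue, hu | hu⟩
    · exact Or.inl ⟨u, hue, hu⟩
    · exact Or.inr ⟨u, hue, hu⟩
  · rintro (⟨u, hue, hu⟩ | ⟨u, hue, hu⟩)
    · exact ⟨u, hue, Or.inl hu⟩
    · exact ⟨u, hue, Or.inr hu⟩

/-- BHK's `X̄(W)` is the set of pairs meeting the vertex span `S ∪ V(W)`. [cite: VandenbergHaggstromKahn2005, §1 p. 8] -/
theorem barOf_eq_edgesOf (S : Set V) (W : Set (Sym2 V)) : barOf S W = edgesOf {v | v ∈ S ∨ ∃ e' ∈ W, v ∈ e'} := by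
  ext e
  simp only [barOf, edgesOf, mem_setOf_eq]

/-- The cut set of `Y` is unchanged by deleting the cut set of a vertex set `S` none of whose vertices is joined to `Y`. [folklore] -/
theorem cut_sdiff_cut_of_avoid {ζ : Set (Sym2 V)} {Y S : Set V} (h : ∀ y ∈ Y, ζ ∈ avoidEv y S) :
    cut Y (ζ \ cut S ζ) = cut Y ζ := by
  ext e
  simp only [cut, mem_setOf_eq]
  constructor
  · rintro ⟨u, hue, y, hyY, hyu⟩
    exact ⟨u, hue, y, hyY, hyu.mono (SimpleGraph.fromEdgeSet_mono fun _ he => he.1)⟩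
  · rintro ⟨u, hue, y, hyY, hyu⟩
    exact ⟨u, hue, y, hyY, (reachable_sdiff_cut_iff_of_avoid (h y hyY) u).2 hyu⟩

variable [Fintype V]

/-- Deleting the cut set of a vertex set `S` joined neither to `x` nor to `Y` does not change the residual `Θ`. [folklore] -/
theorem resid_sdiff_cut_of_avoid (w : Sym2 V → ℝ) {x : V} {Y S : Set V} (g : Set (Sym2 V) → ℝ) {ζ : Set (Sym2 V)}
    (hx : ζ ∈ avoidEv x S) (hY : ∀ y ∈ Y, ζ ∈ avoidEv y S) : resid w x Y g (ζ \ cut S ζ) = resid w x Y g ζ := by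
  unfold resid
  have e1 : openEdgeCluster (ζ \ cut S ζ) x = openEdgeCluster ζ x := openEdgeCluster_sdiff_cut_of_avoid hx
  have e2 : wmeanOff w Y (fun β => g (openEdgeCluster β x)) (ζ \ cut S ζ) =
      wmeanOff w Y (fun β => g (openEdgeCluster β x)) ζ := by
    unfold wmeanOff; rw [cut_sdiff_cut_of_avoid hY]
  have e3 : ind (avoidEv x Y) (ζ \ cut S ζ) = ind (avoidEv x Y) ζ := by
    by_cases hxY : ζ ∈ avoidEv x Y
    · rw [ind_of_mem hxY, ind_of_mem]
      exact fun y hy hr => hxY y hy ((reachable_sdiff_cut_iff_of_avoid hx y).1 hr)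
    · rw [ind_of_not_mem hxY, ind_of_not_mem]
      exact fun h' => hxY fun y hy hr => h' y hy ((reachable_sdiff_cut_iff_of_avoid hx y).2 hr)
  rw [e1, e2, e3]

/-- **Lemma Φ(a) for an arbitrary deleted vertex set, residual form**: `Σ_η w(η) Θ(η ∖ edgesOf K) = −Σ_η w(η) I_K(η)`.
(transcription of the cell memo prim-hp-8 PROOF-S5-ALL-R.md §3.2(a)) [folklore] -/
theorem sum_resid_off_eq (w : Sym2 V → ℝ) (hm : ∑ ω, weight w ω = 1) (x : V) (Y K : Set V) (g : Set (Sym2 V) → ℝ) :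
    ∑ η, weight w η * resid w x Y g (η \ edgesOf K) = - ∑ η, weight w η * phiIntegrand x Y K g η := by
  rw [sum_phiIntegrand_eq w hm x Y K g, ← Finset.sum_neg_distrib]
  refine Finset.sum_congr rfl fun η _ => ?_
  unfold resid; ring

/-- **The inner step of the defect lemma (a world with a fixed deleted set `K`)**: for the residual `Θ` of `(x, Y)`, a vertex set
`O'` and an avoided set `A ⊇ {x} ∪ Y`:
`Σ_η w(η) Θ(η∖edgesOf K)·1{O' ≁ A in η∖edgesOf K} ≤ (Σ_η w(η) 1{O' ≁ A in η∖edgesOf K})·(−Σ_η w(η) I_K(η))`.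
Markov at `C_{O'}` explored off `edgesOf K`, Lemma Φ(a) off `K ∪ V(C_{O'})`, and `I_K ≤ I_{K ∪ V(C_{O'})}`.
[cite: VandenbergHaggstromKahn2005, §2.1 Lemma 2.4 (p. 10) — corollary] -/
theorem sum_resid_avoid_off_le (w : Sym2 V → ℝ) (hw0 : ∀ e, 0 ≤ w e) (hw1 : ∀ e, w e ≤ 1) (hm : ∑ ω, weight w ω = 1)
    (x : V) (Y K : Set V) (g : Set (Sym2 V) → ℝ) (hg : Monotone g) (O' A : Set V) (hA : insert x Y ⊆ A) :
    ∑ η, weight w η * (resid w x Y g (η \ edgesOf K) *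
        ind {β : Set (Sym2 V) | ∀ o ∈ O', ∀ a ∈ A, ¬ (openGraph β).Reachable o a} (η \ edgesOf K)) ≤
      (∑ η, weight w η * ind {β : Set (Sym2 V) | ∀ o ∈ O', ∀ a ∈ A, ¬ (openGraph β).Reachable o a} (η \ edgesOf K)) *
        (- ∑ η, weight w η * phiIntegrand x Y K g η) := by
  classical
  set B : Set (Sym2 V) := edgesOf K with hB
  set N : Set (Set (Sym2 V)) := {β : Set (Sym2 V) | ∀ o ∈ O', ∀ a ∈ A, ¬ (openGraph β).Reachable o a} with hN
  -- `1_N` read off the edge cluster of `O'`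
  let nW : Set (Sym2 V) → ℝ := fun W => if (∀ a ∈ A, ¬ (a ∈ O' ∨ ∃ e ∈ W, a ∈ e)) then 1 else 0
  have hnW : ∀ β : Set (Sym2 V), nW (setCl β O') = ind N β := by
    intro β
    have key : (∀ a ∈ A, ¬ (a ∈ O' ∨ ∃ e ∈ setCl β O', a ∈ e)) ↔ β ∈ N := by
      simp only [hN, mem_setOf_eq]
      constructor
      · intro h o ho a ha hoa
        exact h a ha ((setReach_iff β O' a).1 ⟨o, ho, hoa⟩)
      · intro h a ha h'
        obtain ⟨o, ho, hoa⟩ := (setReach_iff β O' a).2 h'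
        exact h o ho a ha hoa
    by_cases hβ : β ∈ N
    · show (if _ then (1:ℝ) else 0) = _; rw [if_pos (key.2 hβ), ind_of_mem hβ]
    · show (if _ then (1:ℝ) else 0) = _; rw [if_neg (fun h' => hβ (key.1 h')), ind_of_not_mem hβ]
  have hnW0 : ∀ W, 0 ≤ nW W := fun W => by show 0 ≤ (if _ then (1:ℝ) else 0); split_ifs <;> norm_num
  -- the kernel: `1_N(C_{O'}) · Θ(γ ∖ B)`
  set K2 : Set (Sym2 V) → Set (Sym2 V) → ℝ := fun W γ => nW W * resid w x Y g (γ \ B) with hK2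
  have key := set_sum_cond_sdiff_off w hm O' B K2
  -- left-hand side: on `N` the residual does not see the clusters of `O'`
  have hL : ∀ η : Set (Sym2 V), weight w η * K2 (setCl (η \ B) O') ((η \ barOf O' (setCl (η \ B) O')) ) =
      weight w η * (resid w x Y g (η \ B) * ind N (η \ B)) := by
    intro η
    simp only [hK2]
    rw [hnW]
    by_cases hη : (η \ B) ∈ N
    · rw [ind_of_mem hη]
      have e : (η \ barOf O' (setCl (η \ B) O')) \ B = (η \ B) \ cut O' (η \ B) := by
        rw [sdiff_right_comm, cut_eq_barOf]
      rw [e, resid_sdiff_cut_of_avoid w g (fun o ho hxo => hη o ho x (hA (mem_insert x Y)) hxo.symm)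
        (fun y hy o ho hyo => hη o ho y (hA (mem_insert_of_mem x hy)) hyo.symm)]
      ring
    · rw [ind_of_not_mem hη]; ring
  -- right-hand side: the fresh mean of the residual off `K ∪ V(C_{O'})` is `−Φ(K ∪ ·) ≤ −Φ(K)`
  have hR : ∀ η : Set (Sym2 V), weight w η * ∑ η', weight w η' * K2 (setCl (η \ B) O') (η' \ barOf O' (setCl (η \ B) O')) ≤
      weight w η * (ind N (η \ B) * (- ∑ η', weight w η' * phiIntegrand x Y K g η')) := by
    intro η
    refine mul_le_mul_of_nonneg_left ?_ (weight_nonneg hw0 hw1 η)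
    simp only [hK2]
    rw [hnW]
    set K' : Set V := K ∪ {v | v ∈ O' ∨ ∃ e' ∈ setCl (η \ B) O', v ∈ e'} with hK'
    have e : ∀ η' : Set (Sym2 V), (η' \ barOf O' (setCl (η \ B) O')) \ B = η' \ edgesOf K' := by
      intro η'
      rw [hK', edgesOf_union, ← barOf_eq_edgesOf, hB, sdiff_sdiff_left]
      show η' \ (barOf O' (setCl (η \ edgesOf K) O') ∪ edgesOf K) = η' \ (edgesOf K ∪ barOf O' (setCl (η \ edgesOf K) O'))
      rw [union_comm]
    have e2 : ∑ η', weight w η' * (ind N (η \ B) * resid w x Y g ((η' \ barOf O' (setCl (η \ B) O')) \ B)) =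
        ind N (η \ B) * ∑ η', weight w η' * resid w x Y g (η' \ edgesOf K') := by
      rw [Finset.mul_sum]
      exact Finset.sum_congr rfl fun η' _ => by rw [e η']; ring
    rw [e2, sum_resid_off_eq w hm x Y K' g]
    refine mul_le_mul_of_nonneg_left (neg_le_neg ?_) (ind_nonneg N _)
    exact Finset.sum_le_sum fun η' _ => mul_le_mul_of_nonneg_left (phiIntegrand_mono x Y subset_union_left hg η') (weight_nonneg hw0 hw1 η')
  calc ∑ η, weight w η * (resid w x Y g (η \ B) * ind N (η \ B))
      = ∑ η, weight w η * K2 (setCl (η \ B) O') (η \ barOf O' (setCl (η \ B) O')) := Finset.sum_congr rfl fun η _ => (hL η).symm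
    _ = ∑ η, weight w η * ∑ η', weight w η' * K2 (setCl (η \ B) O') (η' \ barOf O' (setCl (η \ B) O')) := key
    _ ≤ ∑ η, weight w η * (ind N (η \ B) * (- ∑ η', weight w η' * phiIntegrand x Y K g η')) := Finset.sum_le_sum fun η _ => hR η
    _ = _ := by rw [Finset.sum_mul]; exact Finset.sum_congr rfl fun η _ => by ring


/-- **THE DEFECT LEMMA of the set-observer unfolding** (memo MEMO-gen12 §4(c)).  For the residual `Θ` of `(x, Y)`, a decoy `d` with
avoided set `A ⊇ {x} ∪ Y`, and an observer set `O` with indicator `g_O = 1{O ~ d}·1{O ≁ A}`: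
`Σ_ζ w(ζ)·Θ(ζ)·g_O(ζ) ≤ −Σ_ζ w(ζ)·g_O(ζ)·Φ(C_d(ζ))`.
(For a point observer `o` this is the IDENTITY `CSH.sum_resid_mul_clusterFn` with `f = 1{o ∈ ·}`.)
[cite: VandenbergHaggstromKahn2005, §2.1 Lemma 2.4 (p. 10); §1 display (10) (pp. 7–8) — corollaries] -/
theorem sum_resid_obs_le (w : Sym2 V → ℝ) (hw0 : ∀ e, 0 ≤ w e) (hw1 : ∀ e, w e ≤ 1) (hm : ∑ ω, weight w ω = 1)
    (x : V) (Y : Set V) (g : Set (Sym2 V) → ℝ) (hg : Monotone g) (d : V) {A : Set V} (hA : insert x Y ⊆ A) (O : Finset V) :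
    ∑ ζ, weight w ζ * (resid w x Y g ζ *
        (ind {ζ : Set (Sym2 V) | ∃ o ∈ O, (openGraph ζ).Reachable o d} ζ *
          ind {ζ : Set (Sym2 V) | ∀ o ∈ O, ∀ a ∈ A, ¬ (openGraph ζ).Reachable o a} ζ)) ≤
      - ∑ ζ, weight w ζ * (ind {ζ : Set (Sym2 V) | ∃ o ∈ O, (openGraph ζ).Reachable o d} ζ *
          ind {ζ : Set (Sym2 V) | ∀ o ∈ O, ∀ a ∈ A, ¬ (openGraph ζ).Reachable o a} ζ * phiS w x Y g d ζ) := by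
  classical
  set T : Set (Set (Sym2 V)) := {ζ : Set (Sym2 V) | ∃ o ∈ O, (openGraph ζ).Reachable o d} with hT
  set NO : Set (Set (Sym2 V)) := {ζ : Set (Sym2 V) | ∀ o ∈ O, ∀ a ∈ A, ¬ (openGraph ζ).Reachable o a} with hNO
  -- the pieces of the kernels, read off the edge cluster `W` of `d`
  let tW : Set (Sym2 V) → ℝ := fun W => if (∃ o ∈ O, o = d ∨ ∃ e ∈ W, o ∈ e) then 1 else 0
  let aW : Set (Sym2 V) → ℝ := fun W => if (∀ a ∈ A, ¬ (a ∈ ({d} : Set V) ∨ ∃ e ∈ W, a ∈ e)) then 1 else 0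
  let Orest : Set (Sym2 V) → Set V := fun W => {o | o ∈ O ∧ ¬ (o = d ∨ ∃ e ∈ W, o ∈ e)}
  let NW : Set (Sym2 V) → Set (Set (Sym2 V)) := fun W => {β | ∀ o ∈ Orest W, ∀ a ∈ A, ¬ (openGraph β).Reachable o a}
  let ΦW : Set (Sym2 V) → ℝ := fun W => ∑ η, weight w η * phiIntegrand x Y (insert d {u | ∃ e ∈ W, u ∈ e}) g η
  set K1 : Set (Sym2 V) → Set (Sym2 V) → ℝ := fun W β => tW W * aW W * (resid w x Y g β * ind (NW W) β) with hK1
  set K3 : Set (Sym2 V) → Set (Sym2 V) → ℝ := fun W β => tW W * aW W * (ind (NW W) β * (- ΦW W)) with hK3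
  have key1 := set_sum_cond_sdiff w hm {d} K1
  have key3 := set_sum_cond_sdiff w hm {d} K3
  -- reading the indicators
  have htW : ∀ ζ : Set (Sym2 V), tW (openEdgeCluster ζ d) = ind T ζ := by
    intro ζ
    have e : (∃ o ∈ O, o = d ∨ ∃ e ∈ openEdgeCluster ζ d, o ∈ e) ↔ ζ ∈ T := by
      simp only [hT, mem_setOf_eq]
      constructor
      · rintro ⟨o, ho, h⟩; exact ⟨o, ho, ((reachable_iff_exists_mem_openEdgeCluster ζ d o).2 h).symm⟩
      · rintro ⟨o, ho, h⟩; exact ⟨o, ho, (reachable_iff_exists_mem_openEdgeCluster ζ d o).1 h.symm⟩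
    by_cases h : ζ ∈ T
    · show (if _ then (1:ℝ) else 0) = _; rw [if_pos (e.2 h), ind_of_mem h]
    · show (if _ then (1:ℝ) else 0) = _; rw [if_neg (fun h' => h (e.1 h')), ind_of_not_mem h]
  have haW : ∀ ζ : Set (Sym2 V), aW (openEdgeCluster ζ d) = ind (avoidEv d A) ζ := by
    intro ζ; rw [ind_avoidEv_eq_ite_cluster d A ζ, setCl_singleton]
  have hNW : ∀ ζ : Set (Sym2 V), ζ ∈ avoidEv d A → (ζ \ cut {d} ζ ∈ NW (openEdgeCluster ζ d) ↔ ζ ∈ NO) := by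
    intro ζ hζ
    simp only [hNO, mem_setOf_eq]
    constructor
    · intro h o ho a ha hoa
      by_cases hod : o = d ∨ ∃ e ∈ openEdgeCluster ζ d, o ∈ e
      · exact hζ a ha (((reachable_iff_exists_mem_openEdgeCluster ζ d o).2 hod).trans hoa)
      · have hod' : ζ ∈ avoidEv o {d} := fun t ht hot => by
          rw [mem_singleton_iff] at ht; subst ht
          exact hod ((reachable_iff_exists_mem_openEdgeCluster ζ t o).1 hot.symm)
        exact h o ⟨ho, hod⟩ a ha ((reachable_sdiff_cut_iff_of_avoid hod' a).2 hoa)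
    · rintro h o ⟨ho, hod⟩ a ha hoa
      have hod' : ζ ∈ avoidEv o {d} := fun t ht hot => by
        rw [mem_singleton_iff] at ht; subst ht
        exact hod ((reachable_iff_exists_mem_openEdgeCluster ζ t o).1 hot.symm)
      exact h o ho a ha ((reachable_sdiff_cut_iff_of_avoid hod' a).1 hoa)
  have hTNO : ∀ ζ : Set (Sym2 V), ζ ∉ avoidEv d A → ind T ζ * ind NO ζ = 0 := by
    intro ζ hζ
    by_cases hT' : ζ ∈ T
    · have hNO' : ζ ∉ NO := by
        intro hN
        obtain ⟨o, ho, hod⟩ := hT'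
        exact hζ fun a ha hda => hN o ho a ha (hod.trans hda)
      rw [ind_of_not_mem hNO', mul_zero]
    · rw [ind_of_not_mem hT', zero_mul]
  have hΦW : ∀ ζ : Set (Sym2 V), ΦW (openEdgeCluster ζ d) = phiS w x Y g d ζ := by
    intro ζ; show (∑ η, weight w η * phiIntegrand x Y _ g η) = _
    unfold phiS; rw [openCluster_eq_insert_span]
  -- left kernel on the diagonal
  have hL1 : ∀ ζ : Set (Sym2 V), weight w ζ * K1 (setCl ζ {d}) (ζ \ barOf {d} (setCl ζ {d})) =
      weight w ζ * (resid w x Y g ζ * (ind T ζ * ind NO ζ)) := by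
    intro ζ
    simp only [hK1]
    rw [← cut_eq_barOf, setCl_singleton, htW, haW]
    by_cases hζ : ζ ∈ avoidEv d A
    · rw [ind_of_mem hζ, resid_sdiff_cut_singleton w g (fun a ha => hζ a (hA ha))]
      by_cases hN : ζ ∈ NO
      · rw [ind_of_mem hN, ind_of_mem ((hNW ζ hζ).2 hN)]; ring
      · rw [ind_of_not_mem hN, ind_of_not_mem (fun h => hN ((hNW ζ hζ).1 h))]; ring
    · rw [ind_of_not_mem hζ, hTNO ζ hζ]; ring
  have hL3 : ∀ ζ : Set (Sym2 V), weight w ζ * K3 (setCl ζ {d}) (ζ \ barOf {d} (setCl ζ {d})) =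
      - (weight w ζ * (ind T ζ * ind NO ζ * phiS w x Y g d ζ)) := by
    intro ζ
    simp only [hK3]
    rw [← cut_eq_barOf, setCl_singleton, htW, haW, hΦW]
    by_cases hζ : ζ ∈ avoidEv d A
    · rw [ind_of_mem hζ]
      by_cases hN : ζ ∈ NO
      · rw [ind_of_mem hN, ind_of_mem ((hNW ζ hζ).2 hN)]; ring
      · rw [ind_of_not_mem hN, ind_of_not_mem (fun h => hN ((hNW ζ hζ).1 h))]; ring
    · rw [ind_of_not_mem hζ, hTNO ζ hζ]; ring
  -- the inner inequality, world by world
  have hinner : ∀ ζ : Set (Sym2 V),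
      weight w ζ * ∑ η, weight w η * K1 (setCl ζ {d}) (η \ barOf {d} (setCl ζ {d})) ≤
        weight w ζ * ∑ η, weight w η * K3 (setCl ζ {d}) (η \ barOf {d} (setCl ζ {d})) := by
    intro ζ
    refine mul_le_mul_of_nonneg_left ?_ (weight_nonneg hw0 hw1 ζ)
    simp only [hK1, hK3]
    rw [← cut_eq_barOf, setCl_singleton, cut_singleton_eq_edgesOf]
    have ht0 : 0 ≤ tW (openEdgeCluster ζ d) * aW (openEdgeCluster ζ d) := by
      refine mul_nonneg ?_ ?_
      · show 0 ≤ (if _ then (1:ℝ) else 0); split_ifs <;> norm_num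
      · show 0 ≤ (if _ then (1:ℝ) else 0); split_ifs <;> norm_num
    have e1 : ∑ η, weight w η * (tW (openEdgeCluster ζ d) * aW (openEdgeCluster ζ d) *
        (resid w x Y g (η \ edgesOf (openCluster ζ d)) * ind (NW (openEdgeCluster ζ d)) (η \ edgesOf (openCluster ζ d)))) =
        tW (openEdgeCluster ζ d) * aW (openEdgeCluster ζ d) * ∑ η, weight w η *
          (resid w x Y g (η \ edgesOf (openCluster ζ d)) * ind (NW (openEdgeCluster ζ d)) (η \ edgesOf (openCluster ζ d))) := by
      rw [Finset.mul_sum]; exact Finset.sum_congr rfl fun η _ => by ring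
    have e3 : ∑ η, weight w η * (tW (openEdgeCluster ζ d) * aW (openEdgeCluster ζ d) *
        (ind (NW (openEdgeCluster ζ d)) (η \ edgesOf (openCluster ζ d)) * (- ΦW (openEdgeCluster ζ d)))) =
        tW (openEdgeCluster ζ d) * aW (openEdgeCluster ζ d) *
          ((∑ η, weight w η * ind (NW (openEdgeCluster ζ d)) (η \ edgesOf (openCluster ζ d))) * (- ΦW (openEdgeCluster ζ d))) := by
      rw [Finset.sum_mul, Finset.mul_sum]; exact Finset.sum_congr rfl fun η _ => by ring
    rw [e1, e3]
    refine mul_le_mul_of_nonneg_left ?_ ht0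
    have hcore := sum_resid_avoid_off_le w hw0 hw1 hm x Y (openCluster ζ d) g hg (Orest (openEdgeCluster ζ d)) A hA
    have hΦ : ΦW (openEdgeCluster ζ d) = ∑ η, weight w η * phiIntegrand x Y (openCluster ζ d) g η := by
      show (∑ η, weight w η * phiIntegrand x Y _ g η) = _; rw [openCluster_eq_insert_span]
    rw [hΦ]
    exact hcore
  calc ∑ ζ, weight w ζ * (resid w x Y g ζ * (ind T ζ * ind NO ζ))
      = ∑ ζ, weight w ζ * K1 (setCl ζ {d}) (ζ \ barOf {d} (setCl ζ {d})) := Finset.sum_congr rfl fun ζ _ => (hL1 ζ).symm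
    _ = ∑ ζ, weight w ζ * ∑ η, weight w η * K1 (setCl ζ {d}) (η \ barOf {d} (setCl ζ {d})) := key1
    _ ≤ ∑ ζ, weight w ζ * ∑ η, weight w η * K3 (setCl ζ {d}) (η \ barOf {d} (setCl ζ {d})) := Finset.sum_le_sum fun ζ _ => hinner ζ
    _ = ∑ ζ, weight w ζ * K3 (setCl ζ {d}) (ζ \ barOf {d} (setCl ζ {d})) := key3.symm
    _ = ∑ ζ, - (weight w ζ * (ind T ζ * ind NO ζ * phiS w x Y g d ζ)) := Finset.sum_congr rfl fun ζ _ => hL3 ζ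
    _ = _ := by rw [Finset.sum_neg_distrib]

end CSH

end Summit.CriticalPhenomena.PercolationContinuityZ3.Theorems

end
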